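import Literature.NumberTheory.GaloisRepresentations.LubinTateSeriesIndependence
import HarnessLib

/-!
# The division points of `F_g` lie in the Lubin–Tate tower, and `Γ_F` acts on them through `χ_π` — for every
# `g ∈ 𝔉_π` and every finite `E ⊆ F̄` (the field half of the independence of the series)

Sequel of `LubinTateSeriesIndependence.lean` (the Galois half at `E = K_π^{n+1}`). For a non-archimedean local field `F`,
a uniformizer `π`, ANY Lubin–Tate series `g ∈ 𝔉_π` over `𝒪_F` and ANY finite subextension `E ⊆ F̄`, a point
`x ∈ 𝔪_E` with `[π^{n+1}]_g x = 0`: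

* `inclUnitBall_evalPt₁` / `inclPt_evalPt₁` / `inclPt_ltSMul'` — evaluating a constant-term-free series over `𝒪_F` (in
  particular `[a]_g`) commutes with the inclusions `𝒪_{E₁} ⊆ 𝒪_{E₂}` of finite subextensions (the tree's
  `inclUnitBall_ltSMul` is the case of the standard series);
* ★ `coe_mem_ltField_of_ltSMul_pow_eq_zero` — **`x ∈ K_π^{n+1}`** (Cassels–Fröhlich VI §3.6: `K_π^{n+1} = F(F_g[π^{n+1}])`
  for every `g`; Lubin–Tate 1965 §2): `[1]_{f,g} x` is a root of `f^{(n+1)}`, all of whose roots in `F̄` lie in the splitting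
  field `K_π^{n+1}` (`card_roots_ltPolyIter`, Mathlib `roots_map_of_injective_of_card_eq_natDegree`), and `x = [1]_{g,f}([1]_{f,g} x)`
  is evaluated inside `E ⊓ K_π^{n+1}`;
* ★ `absGal_smul_eq_ltSMul_lubinTateChar_of_mem` — **`σ • x = [χ_π(σ)]_g x` in `F̄` for every `σ ∈ Γ_F`**, the right-hand
  side computed in `𝔪_E` (transport of `absGal_smul_eq_ltSMul_lubinTateChar` along `E ⊓ K_π^{n+1}`).

All proofs complete; no definition, no named fact. Consumers: as in the prequel (the formal group of a supersingular
elliptic curve with `a_p = 0` is `F_g` for a non-standard `g ∈ 𝔉_{−p}`; its `p`-power torsion points live in arbitrary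
finite extensions).

## References
* J. Lubin, J. Tate, Ann. of Math. 81 (1965), §2 Thm. 2 and Cor. [LubinTate1965]
* J.-P. Serre, *Local class field theory* (Cassels–Fröhlich Ch. VI), §3.4 Thm. 3, §3.6 Prop. 6. [CasselsFrohlichANT1967]
-/

noncomputable section

open Filter Topology Polynomial

namespace Literature.NumberTheory.GaloisRepresentations

section Concrete

open ValuativeRel GaloisRepresentations.IsNonarchimedeanLocalField LubinTate

variable {F : Type*} [Field F] [ValuativeRel F] [TopologicalSpace F] [IsNonarchimedeanLocalField F]

section Normed

-- The normed-field instances on `F` and on the finite subextensions of `F̄` are those declared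
-- (as local instances) in `LubinTateTorsion.lean`; re-activated verbatim as in `LubinTateCharacterLimit.lean`.
attribute [local instance] instUniformSpace_literature rk1 nF nE ltCharIsUniformAddGroup

/-! ### §1 Evaluation commutes with the inclusions of finite subextensions -/

section Inclusion

variable {E₁ E₂ : IntermediateField F (AlgebraicClosure F)} [FiniteDimensional F E₁] [FiniteDimensional F E₂]

/-- **The inclusion `𝒪_{E₁} → 𝒪_{E₂}` commutes with the evaluation of ANY constant-term-free series over `𝒪_F`**
(continuity of the isometric inclusion; Mathlib `MvPowerSeries.comp_aeval`). Generalises the tree's `inclUnitBall_ltSMul`.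
[cite: CasselsFrohlichANT1967, Ch. VI §3.2] -/
theorem inclUnitBall_evalPt₁ (h : E₁ ≤ E₂) (k : PowerSeries (LTCoeff F)) (hk : PowerSeries.constantCoeff k = 0)
    (x : (maxNilIdeal F E₁).toIdeal) :
    inclUnitBall h (evalPt₁ (maxNilIdeal F E₁) k hk x) = evalPt₁ (maxNilIdeal F E₂) k hk (inclPt h x) := by
  unfold evalPt₁
  rw [coe_evalPt, coe_evalPt, ← AlgHom.comp_apply, MvPowerSeries.comp_aeval _ (continuous_inclUnitBall h)]
  rfl

/-- The same as an identity of points: `ι(k(x)) = k(ι x)`. [cite: CasselsFrohlichANT1967, Ch. VI §3.2] -/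
theorem inclPt_evalPt₁ (h : E₁ ≤ E₂) (k : PowerSeries (LTCoeff F)) (hk : PowerSeries.constantCoeff k = 0)
    (x : (maxNilIdeal F E₁).toIdeal) :
    inclPt h (evalPt₁ (maxNilIdeal F E₁) k hk x) = evalPt₁ (maxNilIdeal F E₂) k hk (inclPt h x) :=
  Subtype.ext (inclUnitBall_evalPt₁ h k hk x)

/-- `ι([a]_g x) = [a]_g (ι x)` for EVERY Lubin–Tate series `g` (the tree's `inclUnitBall_ltSMul` is the standard `f`).
[cite: CasselsFrohlichANT1967, Ch. VI §3.4] -/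
theorem inclPt_ltSMul' (h : E₁ ≤ E₂) {π : 𝒪[F]} {hA : IsLTRing (LTCoeff.of F π) (residueFieldCard F)}
    {g : PowerSeries (LTCoeff F)} (hg : IsLTSeries (LTCoeff.of F π) (residueFieldCard F) g) (a : LTCoeff F)
    (x : (maxNilIdeal F E₁).toIdeal) :
    inclPt h (ltSMul (maxNilIdeal F E₁) hA hg a x) = ltSMul (maxNilIdeal F E₂) hA hg a (inclPt h x) :=
  inclPt_evalPt₁ h (hom hA hg hg a) (constantCoeff_hom hA hg hg a) x

omit [FiniteDimensional F E₂] in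
/-- A point of `𝔪_E` vanishes iff it vanishes in `F̄`. [cite: CasselsFrohlichANT1967, Ch. VI §3.2] -/
theorem pt_eq_zero_iff (z : (maxNilIdeal F E₁).toIdeal) :
    z = 0 ↔ ((((z : unitBall E₁) : E₁) : AlgebraicClosure F) = 0) := by
  constructor
  · rintro rfl; simp
  · intro h
    apply Subtype.ext; apply Subtype.ext; apply Subtype.ext
    simpa using h

/-- `ι z = 0 ↔ z = 0` for the inclusion of points. [cite: CasselsFrohlichANT1967, Ch. VI §3.2] -/
theorem inclPt_eq_zero_iff (h : E₁ ≤ E₂) (z : (maxNilIdeal F E₁).toIdeal) : inclPt h z = 0 ↔ z = 0 := by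
  rw [pt_eq_zero_iff, pt_eq_zero_iff (F := F) z, coe_inclPt]

end Inclusion

/-! ### §2 Division points of `F_g` in any finite `E ⊆ F̄` lie in `K_π^{n+1}` and are moved by `χ_π` -/

variable {π : 𝒪[F]} (hπ : (valuation F).IsUniformizer (π : F))
variable {E : IntermediateField F (AlgebraicClosure F)} [FiniteDimensional F E]

/-- A point of `𝔪_E` whose underlying element of `F̄` lies in a second finite subextension `K` comes from a point of
`𝔪_{E ⊓ K}` (the spectral norms agree along inclusions). [cite: SerreLocalFields1979, Ch. II §2 Cor. 3] -/
theorem exists_inclPt_inf_eq {K : IntermediateField F (AlgebraicClosure F)} [FiniteDimensional F ↥(E ⊓ K)]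
    (y : (maxNilIdeal F E).toIdeal) (hy : (((y : unitBall E) : E) : AlgebraicClosure F) ∈ K) :
    ∃ y₀ : (maxNilIdeal F (E ⊓ K)).toIdeal, inclPt inf_le_left y₀ = y := by
  let y₀E : ↥(E ⊓ K) := ⟨(((y : unitBall E) : E) : AlgebraicClosure F),
    IntermediateField.mem_inf.2 ⟨SetLike.coe_mem _, hy⟩⟩
  have hinc : IntermediateField.inclusion (inf_le_left : E ⊓ K ≤ E) y₀E = ((y : unitBall E) : E) := rfl
  have hnorm : ‖y₀E‖ = ‖((y : unitBall E) : E)‖ := by rw [← hinc, norm_inclusion]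
  refine ⟨⟨⟨y₀E, ?_⟩, ?_⟩, ?_⟩
  · rw [mem_unitBall_iff, hnorm]; exact (mem_unitBall_iff E).mp (y : unitBall E).2
  · change ‖y₀E‖ < 1
    rw [hnorm]; exact y.2
  · apply Subtype.ext; apply Subtype.ext
    exact hinc

/-- The finite subextension `E ⊓ K_π^{n+1}` is finite over `F`. [cite: CasselsFrohlichANT1967, Ch. VI §3.6] -/
theorem finiteDimensional_inf_ltField (n : ℕ) : FiniteDimensional F ↥(E ⊓ ltField π n) :=
  FiniteDimensional.of_injective (IntermediateField.inclusion (inf_le_left : E ⊓ ltField π n ≤ E)).toLinearMap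
    (IntermediateField.inclusion_injective (inf_le_left : E ⊓ ltField π n ≤ E))

/-- ★ **The `π^{n+1}`-division points of `F_g` lie in `K_π^{n+1}`, for every `g ∈ 𝔉_π`** (Cassels–Fröhlich VI §3.6:
`K_π^{n+1} = F(F_g[π^{n+1}])` does not depend on `g`). For `x ∈ 𝔪_E`, `E ⊆ F̄` finite, with `[π^{n+1}]_g x = 0`:
`x ∈ K_π^{n+1}`. Proof: `y = [1]_{f,g} x ∈ 𝔪_E` is a root of `f^{(n+1)}`, whose `q^{n+1}` roots in `F̄` all lie in
`K_π^{n+1}` (`card_roots_ltPolyIter`, `roots_map_of_injective_of_card_eq_natDegree`); so `y ∈ E ⊓ K_π^{n+1}` and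
`x = [1]_{g,f} y` is computed there. [cite: CasselsFrohlichANT1967, Ch. VI §3.6 Prop. 6 (a)] [cite: LubinTate1965, §2 Thm. 2] -/
theorem coe_mem_ltField_of_ltSMul_pow_eq_zero (n : ℕ) {g : PowerSeries (LTCoeff F)}
    (hg : IsLTSeries (LTCoeff.of F π) (residueFieldCard F) g) (x : (maxNilIdeal F E).toIdeal)
    (hx : ltSMul (maxNilIdeal F E) (isLTRing_LTCoeff hπ) hg ((LTCoeff.of F π) ^ (n + 1)) x = 0) :
    (((x : unitBall E) : E) : AlgebraicClosure F) ∈ ltField π n := by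
  classical
  haveI := finiteDimensional_inf_ltField (F := F) (π := π) (E := E) n
  have hA := isLTRing_LTCoeff (F := F) hπ
  have hf := isLTSeries_LTCoeff (F := F) π
  -- `y := [1]_{f,g} x`, a root of `f^{(n+1)}`
  set y : (maxNilIdeal F E).toIdeal :=
    evalPt₁ (maxNilIdeal F E) (hom hA hf hg 1) (constantCoeff_hom hA hf hg 1) x with hy
  have hy0 : ltSMul (maxNilIdeal F E) hA hf ((LTCoeff.of F π) ^ (n + 1)) y = 0 := by
    rw [hy, ltSMul_evalPt₁_hom_one (maxNilIdeal F E) hA hg hf, hx, LubinTate.evalPt₁_zero]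
  set P : F[X] := (ltPolyIter F π (n + 1)).map (algebraMap 𝒪[F] F) with hP
  have hyE : aeval ((y : unitBall E) : E) P = 0 := by
    rw [hP, ← coe_ltSMul_pow hπ (n + 1) y, hy0]; rfl
  have hyroot : aeval (((y : unitBall E) : E) : AlgebraicClosure F) P = 0 := by
    have h := congrArg (algebraMap E (AlgebraicClosure F)) hyE
    rwa [map_zero, ← Polynomial.aeval_algebraMap_apply] at h
  -- all roots of `f^{(n+1)}` in `F̄` lie in `K_π^{n+1}`
  obtain ⟨hcard, -, -⟩ := card_roots_ltPolyIter hπ n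
  set Q := P.map (algebraMap F (ltField π n)) with hQ
  have hdeg : Q.natDegree = residueFieldCard F ^ (n + 1) := by
    rw [hQ, hP, ((monic_ltPolyIter π (n + 1)).1.map _).natDegree_map,
      (monic_ltPolyIter π (n + 1)).1.natDegree_map, (monic_ltPolyIter π (n + 1)).2]
  have hroots := Polynomial.roots_map_of_injective_of_card_eq_natDegree
    (f := algebraMap (ltField π n) (AlgebraicClosure F)) (algebraMap (ltField π n) (AlgebraicClosure F)).injective
    (p := Q) (by rw [hdeg]; exact hcard)
  have hQmap : Q.map (algebraMap (ltField π n) (AlgebraicClosure F)) = P.map (algebraMap F (AlgebraicClosure F)) := by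
    rw [hQ, Polynomial.map_map, ← IsScalarTower.algebraMap_eq]
  have hP0 : P.map (algebraMap F (AlgebraicClosure F)) ≠ 0 :=
    (((monic_ltPolyIter π (n + 1)).1.map _).map _).ne_zero
  have hmem : (((y : unitBall E) : E) : AlgebraicClosure F) ∈ (P.map (algebraMap F (AlgebraicClosure F))).roots := by
    rw [Polynomial.mem_roots hP0, Polynomial.IsRoot.def, Polynomial.eval_map, ← Polynomial.aeval_def]
    exact hyroot
  rw [← hQmap, ← hroots, Multiset.mem_map] at hmem
  obtain ⟨r, -, hr⟩ := hmem
  have hyK : (((y : unitBall E) : E) : AlgebraicClosure F) ∈ ltField π n := by rw [← hr]; exact SetLike.coe_mem r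
  -- `x = [1]_{g,f} y`, computed in `E ⊓ K_π^{n+1}`
  have hxy : x = evalPt₁ (maxNilIdeal F E) (hom hA hg hf 1) (constantCoeff_hom hA hg hf 1) y :=
    (evalPt₁_hom_one_evalPt₁_hom_one (maxNilIdeal F E) hA hg hf x).symm
  obtain ⟨y₀, hy₀⟩ := exists_inclPt_inf_eq (K := ltField π n) y hyK
  have hx0 : x = inclPt inf_le_left
      (evalPt₁ (maxNilIdeal F (E ⊓ ltField π n)) (hom hA hg hf 1) (constantCoeff_hom hA hg hf 1) y₀) := by
    rw [hxy, ← hy₀, inclPt_evalPt₁]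
  have hcoe : (((x : unitBall E) : E) : AlgebraicClosure F) =
      ((((inclPt (inf_le_right : E ⊓ ltField π n ≤ ltField π n)
          (evalPt₁ (maxNilIdeal F (E ⊓ ltField π n)) (hom hA hg hf 1) (constantCoeff_hom hA hg hf 1) y₀) :
            (maxNilIdeal F (ltField π n)).toIdeal) : unitBall (ltField π n)) : ltField π n) : AlgebraicClosure F) := by
    rw [hx0, coe_inclPt, coe_inclPt]
  rw [hcoe]
  exact SetLike.coe_mem _

/-- ★ **`Γ_F` acts on the `π^{n+1}`-division points of `F_g` in ANY finite `E ⊆ F̄` through `χ_π`**: for `g ∈ 𝔉_π`,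
`x ∈ 𝔪_E` with `[π^{n+1}]_g x = 0` and `σ ∈ Γ_F`: `σ • x = [χ_π(σ)]_g x` in `F̄` (the right-hand side evaluated in `𝔪_E`).
Transport of `absGal_smul_eq_ltSMul_lubinTateChar` through `E ⊓ K_π^{n+1}` (`coe_mem_ltField_of_ltSMul_pow_eq_zero`).
[cite: LubinTate1965, §2 Thm. 2 and Cor.] [cite: CasselsFrohlichANT1967, Ch. VI §3.4 Thm. 3 (b) and §3.6 Prop. 6] -/
theorem absGal_smul_eq_ltSMul_lubinTateChar_of_mem (n : ℕ) {g : PowerSeries (LTCoeff F)}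
    (hg : IsLTSeries (LTCoeff.of F π) (residueFieldCard F) g) (x : (maxNilIdeal F E).toIdeal)
    (hx : ltSMul (maxNilIdeal F E) (isLTRing_LTCoeff hπ) hg ((LTCoeff.of F π) ^ (n + 1)) x = 0)
    (σ : Field.absoluteGaloisGroup F) :
    σ • (((x : unitBall E) : E) : AlgebraicClosure F) =
      (((ltSMul (maxNilIdeal F E) (isLTRing_LTCoeff hπ) hg (LTCoeff.of F (lubinTateChar hπ σ : 𝒪[F])) x :
          unitBall E) : E) : AlgebraicClosure F) := by
  classical
  haveI := finiteDimensional_inf_ltField (F := F) (π := π) (E := E) n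
  have hA := isLTRing_LTCoeff (F := F) hπ
  have hxK := coe_mem_ltField_of_ltSMul_pow_eq_zero hπ n hg x hx
  obtain ⟨x₀, hx₀⟩ := exists_inclPt_inf_eq (K := ltField π n) x hxK
  -- the same point in `𝔪_{K_π^{n+1}}`
  set xK : (maxNilIdeal F (ltField π n)).toIdeal := inclPt inf_le_right x₀ with hxKdef
  have hx00 : ltSMul (maxNilIdeal F (E ⊓ ltField π n)) hA hg ((LTCoeff.of F π) ^ (n + 1)) x₀ = 0 := by
    rw [← inclPt_eq_zero_iff (inf_le_left : E ⊓ ltField π n ≤ E), inclPt_ltSMul' _ hg, hx₀]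
    exact hx
  have hxK0 : ltSMul (maxNilIdeal F (ltField π n)) hA hg ((LTCoeff.of F π) ^ (n + 1)) xK = 0 := by
    rw [hxKdef, ← inclPt_ltSMul' _ hg, hx00, inclPt_eq_zero_iff]
  have main := absGal_smul_eq_ltSMul_lubinTateChar hπ n hg xK hxK0 σ
  have e1 : (((x : unitBall E) : E) : AlgebraicClosure F) =
      (((xK : unitBall (ltField π n)) : ltField π n) : AlgebraicClosure F) := by
    rw [← hx₀, hxKdef, coe_inclPt, coe_inclPt]
  have e2 : (((ltSMul (maxNilIdeal F E) hA hg (LTCoeff.of F (lubinTateChar hπ σ : 𝒪[F])) x :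
        unitBall E) : E) : AlgebraicClosure F) =
      (((ltSMul (maxNilIdeal F (ltField π n)) hA hg (LTCoeff.of F (lubinTateChar hπ σ : 𝒪[F])) xK :
        unitBall (ltField π n)) : ltField π n) : AlgebraicClosure F) := by
    rw [← hx₀, hxKdef, ← inclPt_ltSMul' _ hg, ← inclPt_ltSMul' _ hg, coe_inclPt, coe_inclPt]
  rw [e1, e2]
  exact main

end Normed

end Concrete

end Literature.NumberTheory.GaloisRepresentations

end
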